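import Mathlib
import Summits.Ventures.HodgeRepro.Tier4.Target
import Summits.Ventures.HodgeRepro.Tier4.Line3.Defs

/-!
# Tier4/Line3/GoodSplitBracket — the four-slot bracket of the wall `pos_localiser` at a GOOD SPLIT place (kernel rung)

Blind re-derivation cell `pub-hodge-repro`, Tier 4 «PROVE THE STEP» (README §9–§10), LINE L3, seat t4-L3-p1 (g2),
wall-breaker support for the declared wall `pos_localiser` (Skeleton v0.29 L490; paper proof CENSUS-v0.29.md §1 (i)).
This module is SUPPORT: it is not consumed by any filed statement, it does not touch the wall's statement, and it
proves nothing about `coefQ` — it formalises the LOCAL BOOKKEEPING of §1 (i) over the valuation of the line's prime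
`𝔭` on `E′` itself (no completion, no Haar measure), so that the residual of the wall names only what is genuinely
unformalised (the factorisation of the adelic torus average and the character identity), never the elementary part.

## The objects (CENSUS-v0.29 §1 (i), in the tree's vocabulary)

At a place `w` of `E′⁺` SPLIT in `E′` as `𝔭 𝔭̄`, `E′ ⊗ E′⁺_w = E′_𝔭 × E′_𝔭̄`, a vector `x ∈ E′³` has the two Schrödinger
components `x ∈ E′_𝔭³` and `x ∈ E′_𝔭̄³`, and the local norm-one torus `U(1)(E′⁺_w) ≅ E′_𝔭^×` acts by
`α · x = (α x, c(α)⁻¹ x)`.  For `α = ϖ^k u` (`u` a unit) and the unramified lattice `L_w = 𝒪_𝔭³ × 𝒪_𝔭̄³`,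
`α · x ∈ L_w ⟺ v_𝔭(ϖ^k x_i) ≤ 1 ∧ v_𝔭̄(c(ϖ)^{−k} x_i) ≤ 1 ⟺ v_𝔭(x_i) ≤ ofAdd k ∧ v_𝔭(c(x_i)) ≤ ofAdd (−k)`
(`v_𝔭̄(y) = v_𝔭(c y)`, `v_𝔭(ϖ) = ofAdd (−1)`, Mathlib's convention `v ≤ 1 ⟺ integral`).  This is `IsAdm v c x k`
below — the exponent `k` is ADMISSIBLE for `x`.  The torus average of the lattice indicator against an UNRAMIFIED
character `μ` with `μ(ϖ) = u` is `Σ_{k admissible} μ(ϖ^k)^{−1} vol(𝒪^×) = vol · Σ_{k admissible} u^{−k}`; it is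
`locAvg v c u vol x` below once the admissible set is known to have at most one element.

## What is proved

* `hform_le`: the ultrametric bound `v (hform c H x y) ≤ A * B` when `H` is `v`-integral, `v (c (x i)) ≤ A`,
  `v (y j) ≤ B`.
* `adm_le` / `adm_eq_of_pair` / `adm_unique`: if `hform c H x y` is a `v`-UNIT then an admissible exponent of `x` is
  `≤` every admissible exponent of `y`; if both `hform c H x y` and `hform c H y x` are units (i.e. `H(a, b)` is a unit
  at `𝔭` and at `𝔭̄`) the exponents AGREE (`k_a = k_b`, the integrality of `ϖ^{k_a − k_b} H(a, b)` and of its mirror);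
  if `hform c H x x` is a unit, `x` has AT MOST ONE admissible exponent (the «single term of the geometric sum»).
* `locAvg_eq_of_adm` / `locAvg_eq_zero`: the value of the local average.
* `bracket_eq_of_adm`: at a class representative with admissible exponent `k`, the four-slot bracket
  `c₀(x) c₁(y) conj(c₂(x) c₃(y))` equals `vol⁴ · (u₀ u₁ conj u₂ conj u₃)^{−k}` — the EXACT place where the product
  character `ε = μ₀ μ₁ μ̄₂ μ̄₃` enters (objection O-L3-7, crit-1 S12813: this factor is `ε_𝔭(ϖ)^{−k}`, nothing in the
  face relation makes it `1`).
* `bracket_nonneg`: with `ε_𝔭(ϖ) = u₀ u₁ conj u₂ conj u₃ = 1` displayed as a HYPOTHESIS, the bracket is a non-negative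
  real (`im = 0 ∧ 0 ≤ re`, the shape of `LocPS.pos`): it is `vol⁴` or `0`.

## What is NOT in this module (the wall's residual, exactly)

(a) the factorisation `cf_j = gaussDef · ∏_v c_{j,v}` of the adelic torus average into local averages and the
identification of `c_{j,v}` at a good split place with `locAvg` (a Haar integral over `E′_𝔭^× = ⊔_k ϖ^k 𝒪^×`, unramified
`μ`) — unprinted in the form the wall needs (t4-lit-2 S12743 / t4-lit-4 S12742); (b) the character identity
`ε ≡ 1` on `U(1)(𝔸_f)`, which the typed data do not carry (O-L3-7); (c) the bad-place bracket (§1 (iii)) and the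
definite-place factor (§1 (B)).  Nothing here asserts anything about the truth of (P); HC_CM is NOT proved by anyone in
this repository.
-/

set_option autoImplicit false

noncomputable section

namespace Summit.Ventures.HodgeRepro.Tier4.Line3

open Summit.Ventures.HodgeRepro.Tier4
open Matrix
open scoped ComplexConjugate WithZero

open scoped Classical

namespace GoodSplit

variable {E : Type*} [Field E]

/-- ADMISSIBLE EXPONENT `k ∈ ℤ` for the vector `x ∈ E′³` at the split place `𝔭` (valuation `v = v_𝔭`, conjugation
`c`): the torus element `ϖ^k · x = (ϖ^k x, c(ϖ)^{−k} x)` lies in the unramified lattice `𝒪_𝔭³ × 𝒪_𝔭̄³`, i.e.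
`v_𝔭(x_i) ≤ ofAdd k` and `v_𝔭̄(x_i) = v_𝔭(c x_i) ≤ ofAdd (−k)` for every coordinate. -/
def IsAdm (v : Valuation E ℤᵐ⁰) (c : E ≃+* E) (x : Fin 3 → E) (k : ℤ) : Prop :=
  (∀ i, v (x i) ≤ ↑(Multiplicative.ofAdd k)) ∧ ∀ i, v (c (x i)) ≤ ↑(Multiplicative.ofAdd (-k))

/-- The ultrametric bound for the hermitian form: `v (⟨x, y⟩_H) ≤ A * B` when the entries of `H` are `v`-integral,
`v (c (x i)) ≤ A` and `v (y j) ≤ B`. -/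
theorem hform_le (v : Valuation E ℤᵐ⁰) (c : E ≃+* E) (H : Matrix (Fin 3) (Fin 3) E)
    (hH : ∀ i j, v (H i j) ≤ 1) {x y : Fin 3 → E} {A B : ℤᵐ⁰}
    (hx : ∀ i, v (c (x i)) ≤ A) (hy : ∀ j, v (y j) ≤ B) :
    v (hform c H x y) ≤ A * B := by
  unfold hform
  simp only [Matrix.mulVec, dotProduct]
  apply Valuation.map_sum_le
  intro i _
  rw [Valuation.map_mul]
  refine mul_le_mul' (hx i) ?_
  apply Valuation.map_sum_le
  intro j _
  rw [Valuation.map_mul]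
  calc v (H i j) * v (y j) ≤ 1 * B := mul_le_mul' (hH i j) (hy j)
    _ = B := one_mul B

/-- `1 ≤ ofAdd m` in `ℤᵐ⁰` means `0 ≤ m`. -/
theorem nonneg_of_one_le_coe_ofAdd {m : ℤ} (h : (1 : ℤᵐ⁰) ≤ ↑(Multiplicative.ofAdd m)) : 0 ≤ m := by
  rw [WithZero.one_le_coe, ← ofAdd_zero, Multiplicative.ofAdd_le] at h
  exact h

/-- If `⟨x, y⟩_H` is a `v`-unit, every admissible exponent of `x` is at most every admissible exponent of `y`:
`ϖ^{k} x` and `ϖ^{−k'} y` are integral at `𝔭̄` resp. `𝔭`, so `ϖ^{k − k'} ⟨x, y⟩_H` is integral at `𝔭`. -/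
theorem adm_le (v : Valuation E ℤᵐ⁰) (c : E ≃+* E) (H : Matrix (Fin 3) (Fin 3) E)
    (hH : ∀ i j, v (H i j) ≤ 1) {x y : Fin 3 → E} {k k' : ℤ}
    (hx : IsAdm v c x k) (hy : IsAdm v c y k') (hxy : v (hform c H x y) = 1) : k ≤ k' := by
  have h := hform_le v c H hH hx.2 hy.1
  rw [hxy, ← WithZero.coe_mul, ← ofAdd_add] at h
  have := nonneg_of_one_le_coe_ofAdd h
  omega

/-- `k_a = k_b`: if `⟨x, y⟩_H` and `⟨y, x⟩_H` are both `v`-units (`H(a, b)` a unit at `𝔭` and at `𝔭̄`), the admissible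
exponents of `x` and `y` coincide. -/
theorem adm_eq_of_pair (v : Valuation E ℤᵐ⁰) (c : E ≃+* E) (H : Matrix (Fin 3) (Fin 3) E)
    (hH : ∀ i j, v (H i j) ≤ 1) {x y : Fin 3 → E} {k k' : ℤ}
    (hx : IsAdm v c x k) (hy : IsAdm v c y k') (hxy : v (hform c H x y) = 1)
    (hyx : v (hform c H y x) = 1) : k = k' :=
  le_antisymm (adm_le v c H hH hx hy hxy) (adm_le v c H hH hy hx hyx)

/-- THE SINGLE TERM: if `⟨x, x⟩_H` is a `v`-unit, `x` has at most one admissible exponent. -/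
theorem adm_unique (v : Valuation E ℤᵐ⁰) (c : E ≃+* E) (H : Matrix (Fin 3) (Fin 3) E)
    (hH : ∀ i j, v (H i j) ≤ 1) {x : Fin 3 → E} {k k' : ℤ}
    (hk : IsAdm v c x k) (hk' : IsAdm v c x k') (hxx : v (hform c H x x) = 1) : k = k' :=
  adm_eq_of_pair v c H hH hk hk' hxx hxx

/-- THE UNRAMIFIED LOCAL TORUS AVERAGE of the lattice indicator at `x`, twisted by the unramified character with
`μ(ϖ) = u` and normalised by `vol = vol(𝒪^×)`: `vol · u^{−k}` at the admissible exponent `k` of `x` (chosen; unique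
when `⟨x, x⟩_H` is a unit), `0` if `x` has no admissible exponent. -/
def locAvg (v : Valuation E ℤᵐ⁰) (c : E ≃+* E) (u : ℂ) (vol : ℝ) (x : Fin 3 → E) : ℂ :=
  if h : ∃ k : ℤ, IsAdm v c x k then (vol : ℂ) * u ^ (-(Classical.choose h)) else 0

/-- A vector with no admissible exponent has local average `0` (the torus orbit misses the lattice). -/
theorem locAvg_eq_zero (v : Valuation E ℤᵐ⁰) (c : E ≃+* E) (u : ℂ) (vol : ℝ) {x : Fin 3 → E}
    (h : ¬ ∃ k : ℤ, IsAdm v c x k) : locAvg v c u vol x = 0 := by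
  unfold locAvg
  rw [dif_neg h]

/-- At a vector with `⟨x, x⟩_H` a unit and admissible exponent `k`, the local average is the SINGLE term `vol · u^{−k}`. -/
theorem locAvg_eq_of_adm (v : Valuation E ℤᵐ⁰) (c : E ≃+* E) (H : Matrix (Fin 3) (Fin 3) E)
    (hH : ∀ i j, v (H i j) ≤ 1) (u : ℂ) (vol : ℝ) {x : Fin 3 → E} {k : ℤ}
    (hk : IsAdm v c x k) (hxx : v (hform c H x x) = 1) :
    locAvg v c u vol x = (vol : ℂ) * u ^ (-k) := by
  unfold locAvg
  have h : ∃ k : ℤ, IsAdm v c x k := ⟨k, hk⟩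
  rw [dif_pos h]
  have hc : Classical.choose h = k := adm_unique v c H hH (Classical.choose_spec h) hk hxx
  rw [hc]

/-- THE FOUR-SLOT BRACKET at the pair `(x, y) = (g a, g b)` of a class representative `g • xm`, `xm = (a, b, a, b)`:
`c₀(x) c₁(y) · conj(c₂(x) c₃(y))` with the slot values `u j = μ_j(ϖ)`. -/
def bracket (v : Valuation E ℤᵐ⁰) (c : E ≃+* E) (u : Fin 4 → ℂ) (vol : ℝ) (x y : Fin 3 → E) : ℂ :=
  locAvg v c (u 0) vol x * locAvg v c (u 1) vol y * conj (locAvg v c (u 2) vol x * locAvg v c (u 3) vol y)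

/-- THE VALUE OF THE BRACKET at a representative with admissible exponent `k` for `x` (hence for `y`):
`vol⁴ · (u₀ u₁ conj u₂ conj u₃)^{−k}` — the phase is the product character `ε_𝔭(ϖ)^{−k}`. -/
theorem bracket_eq_of_adm (v : Valuation E ℤᵐ⁰) (c : E ≃+* E) (H : Matrix (Fin 3) (Fin 3) E)
    (hH : ∀ i j, v (H i j) ≤ 1) (u : Fin 4 → ℂ) (vol : ℝ) {x y : Fin 3 → E} {k k' : ℤ}
    (hx : IsAdm v c x k) (hy : IsAdm v c y k')
    (hxx : v (hform c H x x) = 1) (hyy : v (hform c H y y) = 1)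
    (hxy : v (hform c H x y) = 1) (hyx : v (hform c H y x) = 1) :
    bracket v c u vol x y = ((vol : ℂ) ^ 4) * (u 0 * u 1 * conj (u 2) * conj (u 3)) ^ (-k) := by
  have hkk : k = k' := adm_eq_of_pair v c H hH hx hy hxy hyx
  subst hkk
  unfold bracket
  rw [locAvg_eq_of_adm v c H hH (u 0) vol hx hxx, locAvg_eq_of_adm v c H hH (u 1) vol hy hyy,
    locAvg_eq_of_adm v c H hH (u 2) vol hx hxx, locAvg_eq_of_adm v c H hH (u 3) vol hy hyy]
  simp only [map_mul, Complex.conj_ofReal, map_zpow₀]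
  rw [mul_zpow, mul_zpow, mul_zpow]
  ring

/-- TERMWISE POSITIVITY AT A GOOD SPLIT PLACE, under the DISPLAYED character identity `ε_𝔭(ϖ) = 1`: the bracket is a
non-negative real (`vol⁴` at an admissible representative, `0` otherwise; no sign condition on `vol` is needed for an even power). -/
theorem bracket_nonneg (v : Valuation E ℤᵐ⁰) (c : E ≃+* E) (H : Matrix (Fin 3) (Fin 3) E)
    (hH : ∀ i j, v (H i j) ≤ 1) (u : Fin 4 → ℂ) (hε : u 0 * u 1 * conj (u 2) * conj (u 3) = 1)
    (vol : ℝ) {x y : Fin 3 → E}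
    (hxx : v (hform c H x x) = 1) (hyy : v (hform c H y y) = 1)
    (hxy : v (hform c H x y) = 1) (hyx : v (hform c H y x) = 1) :
    (bracket v c u vol x y).im = 0 ∧ 0 ≤ (bracket v c u vol x y).re := by
  by_cases hx : ∃ k : ℤ, IsAdm v c x k
  · by_cases hy : ∃ k : ℤ, IsAdm v c y k
    · obtain ⟨k, hk⟩ := hx
      obtain ⟨k', hk'⟩ := hy
      rw [bracket_eq_of_adm v c H hH u vol hk hk' hxx hyy hxy hyx, hε, _root_.one_zpow, mul_one]
      have h4 : ((vol : ℂ) ^ 4) = ((vol ^ 4 : ℝ) : ℂ) := by push_cast; ring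
      rw [h4, Complex.ofReal_im, Complex.ofReal_re]
      exact ⟨rfl, by positivity⟩
    · unfold bracket
      rw [locAvg_eq_zero v c (u 1) vol hy, locAvg_eq_zero v c (u 3) vol hy]
      simp
  · unfold bracket
    rw [locAvg_eq_zero v c (u 0) vol hx, locAvg_eq_zero v c (u 2) vol hx]
    simp

end GoodSplit

namespace T4Data

variable (X : T4Data)

/-- The admissible exponents of `x ∈ V(E′)` at the line's prime `𝔭` (the split place of the localiser), with the
valuation `v_𝔭` of `E′` (Mathlib's `IsDedekindDomain.HeightOneSpectrum.valuation`) and the conjugation `c′ = X.c`. -/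
def IsAdmAt (p : IsDedekindDomain.HeightOneSpectrum (NumberField.RingOfIntegers X.E)) (x : Fin 3 → X.E) (k : ℤ) :
    Prop :=
  GoodSplit.IsAdm (p.valuation X.E) X.c x k

/-- The four-slot bracket of the line at `𝔭`, for slot values `u j = μ_{j,𝔭}(ϖ)` and the torus volume `vol`. -/
def splitBracket (p : IsDedekindDomain.HeightOneSpectrum (NumberField.RingOfIntegers X.E)) (u : Fin 4 → ℂ)
    (vol : ℝ) (x y : Fin 3 → X.E) : ℂ :=
  GoodSplit.bracket (p.valuation X.E) X.c u vol x y

/-- `k_a = k_b` at a good split place of the line: if the hermitian form `X.H` is `𝔭`-integral and `⟨x, y⟩_H`,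
`⟨y, x⟩_H` are `𝔭`-units, admissible exponents of `x` and `y` agree. -/
theorem isAdmAt_eq_of_pair (p : IsDedekindDomain.HeightOneSpectrum (NumberField.RingOfIntegers X.E))
    (hH : ∀ i j, p.valuation X.E (X.H i j) ≤ 1) {x y : Fin 3 → X.E} {k k' : ℤ}
    (hx : X.IsAdmAt p x k) (hy : X.IsAdmAt p y k')
    (hxy : p.valuation X.E (hform X.c X.H x y) = 1) (hyx : p.valuation X.E (hform X.c X.H y x) = 1) : k = k' :=
  GoodSplit.adm_eq_of_pair (p.valuation X.E) X.c X.H hH hx hy hxy hyx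

/-- TERMWISE POSITIVITY of the line's bracket at a good split place `𝔭`, under the displayed identity
`ε_𝔭(ϖ) = u 0 * u 1 * conj (u 2) * conj (u 3) = 1` (the finite part of the product character at `𝔭`, which the
typed data do not carry — O-L3-7) and the unit conditions on `H(a, a)`, `H(b, b)`, `H(a, b)` at `𝔭` and `𝔭̄`. -/
theorem splitBracket_nonneg (p : IsDedekindDomain.HeightOneSpectrum (NumberField.RingOfIntegers X.E))
    (hH : ∀ i j, p.valuation X.E (X.H i j) ≤ 1) (u : Fin 4 → ℂ)
    (hε : u 0 * u 1 * conj (u 2) * conj (u 3) = 1) (vol : ℝ) {x y : Fin 3 → X.E}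
    (hxx : p.valuation X.E (hform X.c X.H x x) = 1) (hyy : p.valuation X.E (hform X.c X.H y y) = 1)
    (hxy : p.valuation X.E (hform X.c X.H x y) = 1) (hyx : p.valuation X.E (hform X.c X.H y x) = 1) :
    (X.splitBracket p u vol x y).im = 0 ∧ 0 ≤ (X.splitBracket p u vol x y).re :=
  GoodSplit.bracket_nonneg (p.valuation X.E) X.c X.H hH u hε vol hxx hyy hxy hyx

end T4Data

end Summit.Ventures.HodgeRepro.Tier4.Line3

end
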